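import Literature.AlgebraicGeometry.Motives.EtaleSheafULiftInjective
import Literature.AlgebraicGeometry.Motives.EtaleToProetLeray
import HarnessLib

/-!
# Étale cohomology is independent of the coefficient universe

`EtaleSheafULiftInjective.lean` proves that the change of coefficient universe
`ulift = uliftEtSheaf X : Shv(X_ét, Ab.{u}) → Shv(X_ét, Ab.{u+1})` preserves injective objects
(`injective_uliftEtSheaf_obj`); `EtaleToProetExt.lean` proves that it is additive, exact and fully
faithful. Mathlib's `Functor.mapExt_bijective_of_preservesInjectiveObjects` then makes the maps
`Extⁱ(A, F) → Extⁱ(ulift A, ulift F)` bijective, and with `ulift ℤ_X ≅ ℤ_X` (Milne II 2.18 (a) in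
both universes, `constantSheafIsoContinuousMapEtSheaf`, `constantSheafULiftIsoContinuousMapEtSheaf`)
this is the statement that **`Hⁱ(X_ét, F)` does not depend on the universe in which the
coefficients are taken**: `sheafHUliftEtSheafEquiv : Hⁱ(X_ét, F) ≃+ Hⁱ(X_ét, ulift F)`, canonical
and natural in `F` (`sheafHUliftEtSheafEquiv_naturality`). The comparison facts of this cluster
(`nonempty_addEquiv_sheafH_etaleToProetPullback`, Bhatt–Scholze Cor. 5.1.6, whose two sides live
in `Type u` and `Type (u+1)`) implicitly contain this statement; here it is isolated, so that
étale cohomology with `Ab.{u}`- and `Ab.{u+1}`-coefficients may be exchanged freely.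

## References

* J. S. Milne, *Étale cohomology* (2025 reissue, held): II Examples 2.18 (a); III Remark 1.6 (e)
  (`Hⁱ = Extⁱ(ℤ, –)`). [Milne2025]
* B. Bhatt, P. Scholze, *The pro-étale topology for schemes*, Astérisque 369 (2015): Remark 4.1.2
  (independence of cardinal bounds). [BhattScholze2015]

## Design notes

* Only a definition with body (the equivalence) and theorems; no named facts (D-0026).
* `PreservesInjectiveObjects (uliftEtSheaf X)` is registered as an instance on this tree's own
  functor `uliftEtSheaf`; `Ext` in `Shv(X_ét, Ab.{u+1})` uses the Grothendieck-abelian instance of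
  `EtaleToProetLeray.lean`.
* Mathlib searches: `Functor.mapExt_bijective_of_preservesInjectiveObjects`, `Functor.mapExtAddHom`,
  `Ext.mapExactFunctor_comp`/`_mk₀`; no universe-comparison of sheaf cohomology in Mathlib.
  Nothing restated.
-/

universe u

open CategoryTheory Limits Opposite AlgebraicGeometry

noncomputable section

namespace Literature.AlgebraicGeometry.Motives

variable (X : Scheme.{u})

/-- `uliftEtSheaf X` preserves injective objects (`injective_uliftEtSheaf_obj`). [folklore] -/
instance preservesInjectiveObjects_uliftEtSheaf : (uliftEtSheaf X).PreservesInjectiveObjects where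
  injective_obj {I} hI := by
    haveI := hI
    exact injective_uliftEtSheaf_obj X I

/-- `ulift ℤ_X ≅ ℤ_X`: the lift of the constant étale sheaf `ℤ` (coefficients `Ab.{u}`) to
`Ab.{u+1}` is the constant étale sheaf `ℤ` with coefficients in `Ab.{u+1}` (Milne II 2.18 (a) in
both universes). [cite: Milne2025, II Examples 2.18 (a)] -/
def uliftEtSheafConstantIntIso :
    (uliftEtSheaf X).obj
        ((constantSheaf X.smallEtaleTopology AddCommGrpCat.{u}).obj
          (AddCommGrpCat.of (ULift.{u} ℤ))) ≅
      (constantSheaf X.smallEtaleTopology AddCommGrpCat.{u + 1}).obj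
        (AddCommGrpCat.of (ULift.{u + 1} ℤ)) :=
  (sheafCompose X.smallEtaleTopology AddCommGrpCat.uliftFunctor.{u + 1, u}).mapIso
      (constantSheafIsoContinuousMapEtSheaf X ℤ) ≪≫
    (constantSheafULiftIsoContinuousMapEtSheaf X ℤ).symm

/-- **Étale cohomology does not depend on the coefficient universe**: for every abelian étale
sheaf `F` with coefficients in `Ab.{u}` and every `i`, `Hⁱ(X_ét, F) ≃+ Hⁱ(X_ét, ulift F)`
canonically — the map induced on `Extⁱ(ℤ_X, –)` by the additive, exact, fully faithful,
injective-preserving `ulift` (Mathlib `Functor.mapExt_bijective_of_preservesInjectiveObjects`)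
followed by `ulift ℤ_X ≅ ℤ_X`. [folklore] -/
def sheafHUliftEtSheafEquiv (F : Sheaf X.smallEtaleTopology AddCommGrpCat.{u}) (i : ℕ) :
    (F.H i : Type u) ≃+ ((uliftEtSheaf X).obj F).H i :=
  (AddEquiv.ofBijective ((uliftEtSheaf X).mapExtAddHom _ F i)
    ((uliftEtSheaf X).mapExt_bijective_of_preservesInjectiveObjects _ F i)).trans
    (extAddEquivOfIsoLeft (uliftEtSheafConstantIntIso X) i).symm

/-- On elements: `sheafHUliftEtSheafEquiv` is `Ext.mapExactFunctor ulift` followed by the transport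
along `ulift ℤ_X ≅ ℤ_X`. [folklore] -/
theorem sheafHUliftEtSheafEquiv_apply (F : Sheaf X.smallEtaleTopology AddCommGrpCat.{u}) (i : ℕ)
    (x : F.H i) :
    sheafHUliftEtSheafEquiv X F i x =
      (Abelian.Ext.mk₀ (uliftEtSheafConstantIntIso X).inv).comp
        (x.mapExactFunctor (uliftEtSheaf X)) (zero_add i) :=
  rfl

/-- **The universe comparison is natural in the sheaf**: it commutes with the maps induced on
cohomology by `f : F ⟶ G` and `ulift f`. [folklore] -/
theorem sheafHUliftEtSheafEquiv_naturality {F G : Sheaf X.smallEtaleTopology AddCommGrpCat.{u}}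
    (f : F ⟶ G) (i : ℕ) (x : F.H i) :
    sheafHUliftEtSheafEquiv X G i (Sheaf.H.map f i x) =
      Sheaf.H.map ((uliftEtSheaf X).map f) i (sheafHUliftEtSheafEquiv X F i x) := by
  simp only [sheafHUliftEtSheafEquiv_apply, Sheaf.H.map_apply]
  rw [Abelian.Ext.mapExactFunctor_comp, Abelian.Ext.mapExactFunctor_mk₀,
    Abelian.Ext.comp_assoc_of_third_deg_zero]

end Literature.AlgebraicGeometry.Motives

end
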